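import Summits.HubbardSuperconductivity.HubbardSuperconductivity.Theses.ParentFirstSMA
import Summits.HubbardSuperconductivity.HubbardSuperconductivity.Theorems.ParityGapRigidityNoUniformParityGap
import Summits.HubbardSuperconductivity.HubbardSuperconductivity.Theorems.ParentFirstSMABoundCoherentDWavePairsPairGapBinding
import Literature.MathematicalPhysics.QuantumLattice.HubbardModelParticleHoleProofs
import Literature.MathematicalPhysics.QuantumLattice.HubbardOneParticleCost
import Literature.MathematicalPhysics.QuantumLattice.FinDimSpectrumProofs
import HarnessLib

/-!
# Stub `stub_pairingGapWindow` of line `birth` (crux `DiluteDWavePairsCondense`,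
# stmt-HubbardSuperconductivity-10771, route `ParentFirstSMA`) — FORMAL AUDIT (stub-worker of lead c14)

VERDICT: `stub-blocked: none-in-tree`. The registered signature

  `∀ U ∈ [12,24], (a) uniform half-filled charge gap → (b) uniform two-hole binding →
     ∃ δ₀ > 0, ∃ b' > 0, ∃ L₀, ∀ even L ≥ L₀, ∀ even N, (1-δ₀)L² ≤ N → N+2 ≤ L² → b' ≤ Δ_c(N)`

(`Δ_c(N) = chargeGap (fermionTorusGraph 2 L) 1 U N = E(N+1) + E(N-1) - 2E(N)`,
`E = groundEnergyAt (fermionTorusGraph 2 L) 1 U`) is neither provable nor refutable from tree facts: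

(1) (a) ∧ (b) are NOT jointly contradictory by anything proved. By the particle–hole identity
    `groundEnergyAt_fermionTorus_particleHole` (a) is `μ_L := E(L²) - E(L²-1) ≤ (U - g)/2`
    (`chargeGap_halfFilling_eq_sub` below) and (b) is `Δ_c(L²-1) ≤ -b`, i.e.
    `μ'_L := E(L²-1) - E(L²-2) ≥ μ_L + b` (`twoHoleBinding_eq_neg_chargeGap`,
    `hyps_iff_chemicalPotentials`): two independent linear constraints on three sector energies.
    The only proved a-priori constraints on sector energies in the tree are the one-sided Lipschitz
    bounds `ThermodynamicLimit.groundEnergyAt_succ_le` / `groundEnergyAt_pred_le`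
    (`|E(N±1) - E(N)| ≤ O(2+|U|)` at densities bounded away from `0` and `2`), subadditivity/tiling
    (`HubbardTorus2DTiling`, `HubbardTorus2DEnergyDensity*`), the doublon bound `U⟨D⟩ ≤ 4N`
    (`HubbardGroundStateDoublonBound`), `SU(2)` sector bookkeeping
    (`groundEnergyAt_eq_minEnergyOn_szSector`) and the half-filling identity
    `stub_pairGap_sub_eq_twice_binding` (`2Δ_c(L²) - Δ_p(L²) = 2·binding`). None has a sign: they bound
    `Δ_c` in absolute value only (`abs_chargeGap_torus_le_of_window` below: `|Δ_c(N)| ≤ 108(2+|U|)` on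
    `L²/2 ≤ N ≤ L²-1`), so (a) (`g` small) and (b) (`b` small) are consistent with every proved fact.
(2) The conclusion is NOT refutable a priori: it quantifies EVEN `N` only, and the even-`N` sum
    `Σ_k Δ_c(L²-2k) = Σ_k [μ(L²-2k+1) - μ(L²-2k)]` does not telescope (it is the odd–even staggering;
    the telescoping sum over CONSECUTIVE `N` only forces `Δ_c(odd N) ≤ -b' + O(1/(δ₀L²))` on average —
    pairing, not a contradiction); `|Δ_c(N)| ≤ 108(2+|U|)` leaves room for any small `b'`.
    No junk values enter: all particle numbers used are `≤ L² + 1 < 2L²` (`L ≥ 2`), `N ≥ (1-δ₀)L² > 0`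
    keeps the truncated `N - 1` honest for `δ₀ < 1` (the prover chooses `δ₀`), `L₀` is existential, and
    for `L² ≥ 2/δ₀` the window contains `N = L² - 2`, so the conclusion is never vacuous. No quantifier
    defect found (not `stub-misstated`).
(3) Open content, certified below: the conclusion at ANY single `U > 0`
    (`not_noUniformParityGap_of_pairingGapWindow`) refutes the kill criterion
    `ParityGapRigidity.NoUniformParityGap` (item stmt-HubbardSuperconductivity-2198, OPEN; its tree file
    `Theorems/ParityGapRigidityNoUniformParityGap.lean` records that neither it nor its negation is
    proved anywhere in print). Hence (`stub_decides_noUniformParityGap`) a proof of this stub decides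
    that open item as soon as (a) ∧ (b) hold at one `U ∈ [12,24]` (the route's own witness: crux #3 +
    `MottGapFromSingleMode`). Nearest existing statements (none implies the stub even if proved):
    `Cruxes.DiluteBECBridge.Birth.stub_pairGapPersists` (same physics; window `U ∈ [2,8]`, Cooper-pair
    hypotheses, one filling `N_L(δ)` per `δ`; unproved stub of crux 10314) and clause (PG) of
    `Theses.ParityGapRigidity.GappedWindow` (`∃ U, ∃ δ` form; open crux 2196).
    What would be needed: a finite-density pairing-gap theorem for the 2D repulsive Hubbard torus —
    persistence of the two-hole bound state as an `L`-uniform odd–even gap at all even fillings of a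
    doping window `(0, δ₀]` (Randeria–Duan–Shieh 1989 / Dagotto RMP 66 §IV: numerics only; threats:
    Emery–Kivelson–Lin phase separation at `δ → 0⁺`, three- and four-hole clusters, stripes, nodal BCS regime).

playbook: none fit (no playbook in payload). Searches: `lean search chargeGap` (78 hits, all
bookkeeping); tree-wide grep of theorems named `*groundEnergyAt*|*chargeGap*|*pairGap*|*binding*`
(energy facts listed in (1)); headers of `HubbardOneParticleCost`, `HubbardGroundStateDoublonBound`,
`GriffithsLemmaGroundStates`, `FreeFermionSectorEnergyDeviation`, `TorusPairSusceptibility`,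
`HubbardGapBounds`, `HubbardAtomicLimit`; `ParityGapRigidityNoUniformParityGap` and the sibling skeleton
`Cruxes/DiluteBECBridge/Lines/birth.lean` read in full.

This file is sorry-free bookkeeping over proved tree lemmas; it does NOT prove the stub. Landed by the
lead (c14) as an audit helper `--supports stmt-HubbardSuperconductivity-10771` under the registered
sub-goal `pairingGapWindow_decides_noUniformParityGap`. No definitions.
-/

set_option linter.dupNamespace false

noncomputable section

namespace Summit.HubbardSuperconductivity.HubbardSuperconductivity.Theorems.ParentFirstSMA

open Matrix Finset Filter Literature.Probability.LatticeModels Literature.MathematicalPhysics.QuantumLattice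
open scoped ComplexOrder

/-! ### (1) Normal forms of the two hypotheses -/

/-- Hypothesis (a) in particle–hole normal form: on the even torus, `L ≥ 1`,
`Δ_c(L²) = U - 2·(E(L²) - E(L²-1))` (from `E(L²+1) = E(L²-1) + U`). [cite: LiebWuPhysicaA2003, §1 eq. (3)] -/
theorem chargeGap_halfFilling_eq_sub {L : ℕ} (hL : Even L) (h1 : 1 ≤ L) (U : ℝ) :
    chargeGap (fermionTorusGraph 2 L) 1 U (L ^ 2) =
      U - 2 * (groundEnergyAt (fermionTorusGraph 2 L) 1 U (L ^ 2) -
        groundEnergyAt (fermionTorusGraph 2 L) 1 U (L ^ 2 - 1)) := by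
  have h1' : 1 ≤ L ^ 2 := Nat.one_le_pow _ _ h1
  have hph := groundEnergyAt_fermionTorus2_halfFilling_add hL U (j := 1) h1'
  unfold chargeGap
  rw [hph]
  push_cast
  ring

/-- Hypothesis (b) is minus the charge gap one hole below half filling: for `L ≥ 2`,
`2E(L²-1) - E(L²) - E(L²-2) = -Δ_c(L²-1)` (truncated-subtraction bookkeeping only). [folklore] -/
theorem twoHoleBinding_eq_neg_chargeGap {L : ℕ} (h2 : 2 ≤ L) (U : ℝ) :
    2 * groundEnergyAt (fermionTorusGraph 2 L) 1 U (L ^ 2 - 1) -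
        groundEnergyAt (fermionTorusGraph 2 L) 1 U (L ^ 2) -
        groundEnergyAt (fermionTorusGraph 2 L) 1 U (L ^ 2 - 2) =
      -chargeGap (fermionTorusGraph 2 L) 1 U (L ^ 2 - 1) := by
  have h4 : 4 ≤ L ^ 2 := by
    calc (4 : ℕ) = 2 ^ 2 := by norm_num
      _ ≤ L ^ 2 := Nat.pow_le_pow_left h2 2
  unfold chargeGap
  rw [show L ^ 2 - 1 + 1 = L ^ 2 by omega, show L ^ 2 - 1 - 1 = L ^ 2 - 2 by omega]
  ring

/-- (a) ∧ (b) at one even side `L ≥ 2`, jointly normalised: `g ≤ Δ_c(L²)` and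
`b ≤ 2E(L²-1) - E(L²) - E(L²-2)` say exactly `μ_L ≤ (U-g)/2` and `μ_L + b ≤ μ'_L` for the hole
chemical potentials `μ_L = E(L²) - E(L²-1)`, `μ'_L = E(L²-1) - E(L²-2)` — two independent linear
constraints on three sector energies. [folklore] -/
theorem hyps_iff_chemicalPotentials {L : ℕ} (hL : Even L) (h2 : 2 ≤ L) (U g b : ℝ) :
    (g ≤ chargeGap (fermionTorusGraph 2 L) 1 U (L ^ 2) ∧
        b ≤ 2 * groundEnergyAt (fermionTorusGraph 2 L) 1 U (L ^ 2 - 1) -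
          groundEnergyAt (fermionTorusGraph 2 L) 1 U (L ^ 2) -
          groundEnergyAt (fermionTorusGraph 2 L) 1 U (L ^ 2 - 2)) ↔
      (groundEnergyAt (fermionTorusGraph 2 L) 1 U (L ^ 2) -
            groundEnergyAt (fermionTorusGraph 2 L) 1 U (L ^ 2 - 1) ≤ (U - g) / 2 ∧
        groundEnergyAt (fermionTorusGraph 2 L) 1 U (L ^ 2) -
              groundEnergyAt (fermionTorusGraph 2 L) 1 U (L ^ 2 - 1) + b ≤
          groundEnergyAt (fermionTorusGraph 2 L) 1 U (L ^ 2 - 1) -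
            groundEnergyAt (fermionTorusGraph 2 L) 1 U (L ^ 2 - 2)) := by
  rw [chargeGap_halfFilling_eq_sub hL (by omega) U]
  constructor
  · rintro ⟨ha, hb⟩
    exact ⟨by linarith, by linarith⟩
  · rintro ⟨ha, hb⟩
    exact ⟨by linarith, by linarith⟩

/-! ### (2) The a-priori size of the charge gap in the doping window -/

/-- Weight bookkeeping: `K · a / d ≤ c · K` when `a ≤ c · d`, `d > 0`, `K ≥ 0`. [folklore] -/
private theorem weight_le {K a d c : ℝ} (hK : 0 ≤ K) (hd : 0 < d) (h : a ≤ c * d) :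
    K * a / d ≤ c * K := by
  rw [div_le_iff₀ hd]
  nlinarith [mul_le_mul_of_nonneg_left h hK]

/-- A-priori bound on any graph of maximal degree `≤ Δ`: for `|Λ|/2 ≤ N ≤ |Λ| - 1` the charge gap is
`O(1)` uniformly in the volume, `|Δ_c(N)| ≤ 6K`, `K = (2Δ+1)·2(2|t|+|U|)` (two applications each of
`groundEnergyAt_succ_le` / `groundEnergyAt_pred_le`). [folklore] -/
theorem abs_chargeGap_le {Λ : Type*} [LinearOrder Λ] [Fintype Λ] (G : SimpleGraph Λ)
    [DecidableRel G.Adj] {Δ : ℕ} (hΔ : ∀ x : Λ, #{y | G.Adj x y} ≤ Δ) (t U : ℝ) {N : ℕ}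
    (hlo : Fintype.card Λ ≤ 2 * N) (hhi : N + 1 ≤ Fintype.card Λ) :
    |chargeGap G t U N| ≤ 6 * ((2 * Δ + 1 : ℕ) * (2 * (2 * |t| + |U|))) := by
  obtain ⟨M, rfl⟩ : ∃ M, N = M + 1 := Nat.exists_eq_add_of_le' (by omega : 1 ≤ N)
  have hu := ThermodynamicLimit.groundEnergyAt_succ_le G hΔ t U (N := M + 1) (by omega)
  have hd := ThermodynamicLimit.groundEnergyAt_pred_le G hΔ t U (N := M + 1) (by omega) (by omega)
  have hu' := ThermodynamicLimit.groundEnergyAt_succ_le G hΔ t U (N := M) (by omega)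
  have hd' := ThermodynamicLimit.groundEnergyAt_pred_le G hΔ t U (N := M + 1 + 1) (by omega)
    (by omega)
  rw [Nat.add_sub_cancel] at hd hd'
  have hC1 : (Fintype.card Λ : ℝ) ≤ 2 * ((M : ℝ) + 1) := by exact_mod_cast hlo
  have hC2 : (M : ℝ) + 1 + 1 ≤ (Fintype.card Λ : ℝ) := by exact_mod_cast hhi
  have hM0 : (0 : ℝ) ≤ (M : ℝ) := by positivity
  unfold chargeGap
  rw [Nat.add_sub_cancel]
  push_cast at hu hd hu' hd' ⊢
  set K : ℝ := (2 * (Δ : ℝ) + 1) * (2 * (2 * |t| + |U|)) with hK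
  have hK0 : 0 ≤ K := by positivity
  set C : ℝ := (Fintype.card Λ : ℝ) with hC
  have w1 : K * (2 * C) / (2 * C - ((M : ℝ) + 1)) ≤ 2 * K :=
    weight_le hK0 (by linarith) (by linarith)
  have w2 : K * (2 * C) / ((M : ℝ) + 1) ≤ 4 * K := weight_le hK0 (by linarith) (by linarith)
  have w3 : K * (2 * C) / (2 * C - (M : ℝ)) ≤ 2 * K := weight_le hK0 (by linarith) (by linarith)
  have w4 : K * (2 * C) / ((M : ℝ) + 1 + 1) ≤ 4 * K := weight_le hK0 (by linarith) (by linarith)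
  rw [abs_le]
  constructor <;> linarith

/-- A-priori bound on the torus `(ℤ/Lℤ)²` (degree `≤ 4`, `t = 1`): for `L²/2 ≤ N ≤ L² - 1`,
`|Δ_c(N)| ≤ 108(2 + |U|)` uniformly in `L`. So a uniform `b' > 0` in the stub's conclusion is not
excluded by size; nothing proved in the tree fixes the SIGN of `Δ_c` at even `N < L²`. [folklore] -/
theorem abs_chargeGap_torus_le_of_window {L : ℕ} [NeZero L] (U : ℝ) {N : ℕ} (hlo : L ^ 2 ≤ 2 * N)
    (hhi : N + 1 ≤ L ^ 2) :
    |chargeGap (fermionTorusGraph 2 L) 1 U N| ≤ 108 * (2 + |U|) := by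
  have hcard : Fintype.card (FermionTorus 2 L) = L ^ 2 := by simp [FermionTorus, Fintype.card_fin]
  have hΔ : ∀ x : FermionTorus 2 L, #{y | (fermionTorusGraph 2 L).Adj x y} ≤ 4 := fun x =>
    SourceGas.card_filter_fermionTorusGraph_adj_le (d := 2) x
  have h := abs_chargeGap_le (fermionTorusGraph 2 L) hΔ 1 U (N := N) (by rw [hcard]; exact hlo)
    (by rw [hcard]; exact hhi)
  refine h.trans (le_of_eq ?_)
  push_cast
  rw [abs_one]
  ring

/-! ### (3) The open content: the conclusion decides `NoUniformParityGap` -/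

/-- Floor bookkeeping for the summit filling `N_L = 2⌊(1-δ)L²/2⌋`: if `δ ≤ 1`, `2δ ≤ δ₀` and
`δ L² ≥ 2` then `(1-δ₀)L² ≤ N_L` and `N_L + 2 ≤ L²`. [folklore] -/
theorem sectorNumber_mem_window {δ δ₀ : ℝ} (hδ1 : δ ≤ 1) (hδδ₀ : 2 * δ ≤ δ₀) (L : ℕ)
    (hL : 2 ≤ δ * (L : ℝ) ^ 2) :
    (1 - δ₀) * (L : ℝ) ^ 2 ≤ ((2 * ⌊(1 - δ) * (L : ℝ) ^ 2 / 2⌋₊ : ℕ) : ℝ) ∧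
      2 * ⌊(1 - δ) * (L : ℝ) ^ 2 / 2⌋₊ + 2 ≤ L ^ 2 := by
  set x : ℝ := (1 - δ) * (L : ℝ) ^ 2 / 2 with hx
  have hL2 : (0 : ℝ) ≤ (L : ℝ) ^ 2 := by positivity
  have hx0 : 0 ≤ x := by
    rw [hx]
    exact div_nonneg (mul_nonneg (by linarith) hL2) (by norm_num)
  have hfl : (⌊x⌋₊ : ℝ) ≤ x := Nat.floor_le hx0
  have hlt : x - 1 < (⌊x⌋₊ : ℝ) := Nat.sub_one_lt_floor x
  have h2x : 2 * x = (L : ℝ) ^ 2 - δ * (L : ℝ) ^ 2 := by rw [hx]; ring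
  have hprod : 2 * δ * (L : ℝ) ^ 2 ≤ δ₀ * (L : ℝ) ^ 2 := mul_le_mul_of_nonneg_right hδδ₀ hL2
  constructor
  · push_cast
    linarith
  · have h : ((2 * ⌊x⌋₊ + 2 : ℕ) : ℝ) ≤ ((L ^ 2 : ℕ) : ℝ) := by
      push_cast
      linarith
    exact_mod_cast h

/-- **The stub's conclusion at a single `U > 0` refutes `NoUniformParityGap`** (item
stmt-HubbardSuperconductivity-2198 of route `ParityGapRigidity`, open): a pairing-gap window
`(0, δ₀]` with margin `b'` gives, at `δ = min(δ₀/2, 1/4) ∈ (0, 1/2)`, the `L`-uniform bound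
`Δ_c(N_L) ≥ b' = 2·(b'/2)` at the summit filling `N_L = 2⌊(1-δ)L²/2⌋` along even `L`
(`noUniformParityGap_iff_chargeGap`). [folklore] -/
theorem not_noUniformParityGap_of_pairingGapWindow {U : ℝ} (hU : 0 < U) {δ₀ b' : ℝ}
    (hδ₀ : 0 < δ₀) (hb' : 0 < b')
    (hW : ∃ L₀ : ℕ, ∀ L : ℕ, L₀ ≤ L → Even L → ∀ N : ℕ, Even N →
      (1 - δ₀) * (L : ℝ) ^ 2 ≤ N → N + 2 ≤ L ^ 2 → b' ≤ chargeGap (fermionTorusGraph 2 L) 1 U N) :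
    ¬ Summit.HubbardSuperconductivity.HubbardSuperconductivity.Theses.ParityGapRigidity.NoUniformParityGap := by
  rw [noUniformParityGap_iff_chargeGap]
  intro h
  obtain ⟨L₀, hL₀⟩ := hW
  set δ : ℝ := min (δ₀ / 2) (1 / 4) with hδdef
  have hδpos : 0 < δ := lt_min (by linarith) (by norm_num)
  have hδle : δ ≤ δ₀ / 2 := min_le_left _ _
  have hδ4 : δ ≤ 1 / 4 := min_le_right _ _
  obtain ⟨M, hM⟩ := exists_nat_ge (2 / δ)
  refine h U δ hU ⟨hδpos, by linarith⟩
    ⟨b' / 2, by positivity, max L₀ (max M 1), fun L hL hLe => ?_⟩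
  have hL₀L : L₀ ≤ L := le_trans (le_max_left _ _) hL
  have hML : M ≤ L := le_trans (le_trans (le_max_left _ _) (le_max_right _ _)) hL
  have h1L : 1 ≤ L := le_trans (le_trans (le_max_right _ _) (le_max_right _ _)) hL
  have hLsq : 2 ≤ δ * (L : ℝ) ^ 2 := by
    have hML' : (M : ℝ) ≤ (L : ℝ) := by exact_mod_cast hML
    have h1L' : (1 : ℝ) ≤ (L : ℝ) := by exact_mod_cast h1L
    have hLL : (L : ℝ) ≤ (L : ℝ) ^ 2 := by nlinarith
    have h2δ : 2 / δ ≤ (L : ℝ) ^ 2 := by linarith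
    calc (2 : ℝ) ≤ (L : ℝ) ^ 2 * δ := (div_le_iff₀ hδpos).mp h2δ
      _ = δ * (L : ℝ) ^ 2 := mul_comm _ _
  obtain ⟨hlo, hhi⟩ := sectorNumber_mem_window (δ₀ := δ₀) (by linarith) (by linarith) L hLsq
  have := hL₀ L hL₀L hLe _ (even_two_mul _) hlo hhi
  linarith

/-- **What proving the stub would decide.** If `stub_pairingGapWindow` (its registered signature,
taken here as a hypothesis) holds and hypotheses (a) ∧ (b) are met at one `U ∈ [12, 24]` (the route's
witness: crux `BoundCoherentDWavePairs` with the support `MottGapFromSingleMode`), then the kill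
criterion `NoUniformParityGap` of route `ParityGapRigidity` is refuted — an item documented in the tree
as open in print. This is the formal sense in which the stub is `stub-blocked`. [folklore] -/
theorem stub_decides_noUniformParityGap
    (h₁ : ∀ U : ℝ, 12 ≤ U → U ≤ 24 → (∃ g : ℝ, 0 < g ∧ ∃ L₀ : ℕ, ∀ L : ℕ, L₀ ≤ L → Even L → g ≤ chargeGap (fermionTorusGraph 2 L) 1 U (L ^ 2)) → (∃ b : ℝ, 0 < b ∧ ∃ L₀ : ℕ, ∀ L : ℕ, L₀ ≤ L → Even L → b ≤ 2 * groundEnergyAt (fermionTorusGraph 2 L) 1 U (L ^ 2 - 1) - groundEnergyAt (fermionTorusGraph 2 L) 1 U (L ^ 2) - groundEnergyAt (fermionTorusGraph 2 L) 1 U (L ^ 2 - 2)) → ∃ δ₀ : ℝ, 0 < δ₀ ∧ ∃ b' : ℝ, 0 < b' ∧ (∃ L₀ : ℕ, ∀ L : ℕ, L₀ ≤ L → Even L → ∀ N : ℕ, Even N → (1 - δ₀) * (L : ℝ) ^ 2 ≤ N → N + 2 ≤ L ^ 2 → b' ≤ chargeGap (fermionTorusGraph 2 L) 1 U N))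
    (hw : ∃ U : ℝ, 12 ≤ U ∧ U ≤ 24 ∧
      (∃ g : ℝ, 0 < g ∧ ∃ L₀ : ℕ, ∀ L : ℕ, L₀ ≤ L → Even L →
        g ≤ chargeGap (fermionTorusGraph 2 L) 1 U (L ^ 2)) ∧
      (∃ b : ℝ, 0 < b ∧ ∃ L₀ : ℕ, ∀ L : ℕ, L₀ ≤ L → Even L →
        b ≤ 2 * groundEnergyAt (fermionTorusGraph 2 L) 1 U (L ^ 2 - 1) -
          groundEnergyAt (fermionTorusGraph 2 L) 1 U (L ^ 2) -
          groundEnergyAt (fermionTorusGraph 2 L) 1 U (L ^ 2 - 2))) :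
    ¬ Summit.HubbardSuperconductivity.HubbardSuperconductivity.Theses.ParityGapRigidity.NoUniformParityGap := by
  obtain ⟨U, hU12, hU24, hA, hB⟩ := hw
  obtain ⟨δ₀, hδ₀, b', hb', hW⟩ := h₁ U hU12 hU24 hA hB
  exact not_noUniformParityGap_of_pairingGapWindow (by linarith) hδ₀ hb' hW

/-- **Registered form (lead c14) of the cross-route certificate.** The registered signature of
`stub_pairingGapWindow` together with its hypotheses (a) ∧ (b) at one `U ∈ [12, 24]` refutes the kill
criterion `ParityGapRigidity.NoUniformParityGap` (item stmt-HubbardSuperconductivity-2198): a uniform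
even-filling charge gap on a doping window is exactly what that item denies at every `(U, δ)`.
(`stub_decides_noUniformParityGap` in arrow form.) [folklore] -/
theorem pairingGapWindow_decides_noUniformParityGap : (∀ U : ℝ, 12 ≤ U → U ≤ 24 → (∃ g : ℝ, 0 < g ∧ ∃ L₀ : ℕ, ∀ L : ℕ, L₀ ≤ L → Even L → g ≤ chargeGap (fermionTorusGraph 2 L) 1 U (L ^ 2)) → (∃ b : ℝ, 0 < b ∧ ∃ L₀ : ℕ, ∀ L : ℕ, L₀ ≤ L → Even L → b ≤ 2 * groundEnergyAt (fermionTorusGraph 2 L) 1 U (L ^ 2 - 1) - groundEnergyAt (fermionTorusGraph 2 L) 1 U (L ^ 2) - groundEnergyAt (fermionTorusGraph 2 L) 1 U (L ^ 2 - 2)) → ∃ δ₀ : ℝ, 0 < δ₀ ∧ ∃ b' : ℝ, 0 < b' ∧ (∃ L₀ : ℕ, ∀ L : ℕ, L₀ ≤ L → Even L → ∀ N : ℕ, Even N → (1 - δ₀) * (L : ℝ) ^ 2 ≤ N → N + 2 ≤ L ^ 2 → b' ≤ chargeGap (fermionTorusGraph 2 L) 1 U N)) → (∃ U : ℝ, 12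 ≤ U ∧ U ≤ 24 ∧ (∃ g : ℝ, 0 < g ∧ ∃ L₀ : ℕ, ∀ L : ℕ, L₀ ≤ L → Even L → g ≤ chargeGap (fermionTorusGraph 2 L) 1 U (L ^ 2)) ∧ (∃ b : ℝ, 0 < b ∧ ∃ L₀ : ℕ, ∀ L : ℕ, L₀ ≤ L → Even L → b ≤ 2 * groundEnergyAt (fermionTorusGraph 2 L) 1 U (L ^ 2 - 1) - groundEnergyAt (fermionTorusGraph 2 L) 1 U (L ^ 2) - groundEnergyAt (fermionTorusGraph 2 L) 1 U (L ^ 2 - 2))) → ¬ Summit.HubbardSuperconductivity.HubbardSuperconductivity.Theses.ParityGapRigidity.NoUniformParityGap :=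
  fun h₁ hw => stub_decides_noUniformParityGap h₁ hw

end Summit.HubbardSuperconductivity.HubbardSuperconductivity.Theorems.ParentFirstSMA

end
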